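import Mathlib
import Literature.MathematicalPhysics.QuantumLattice.YangMillsClassical
import Literature.MathematicalPhysics.QuantumLattice.GrassmannIntegralProofs
import HarnessLib

/-!
# Zero-mode action floor — chirality projections of a Dirac-harmonic spinor field (lead c7, line
`zero-mode-floor-dilute-gas` of crux `NestedDissectionSea.EarlyCrosserLaw`, stmt-QuantumFields-13995)

Helpers for the registered stub `stub_floorAssembly`.  The tree's chiral-basis gamma matrices are
block OFF-diagonal for the splitting of the spinor index into `{0,1} | {2,3}` (`γ₅ = diag(1,1,−1,−1)`),
so the projections `ψ₊` (components `0,1`) and `ψ₋` (components `2,3`) of a solution of the twisted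
Dirac equation `Σ_μ γ_μ ∇_μ ψ = 0` are again solutions; they are smooth when `ψ` is, and the modulus
and covariant-gradient densities split additively.
-/

noncomputable section

open scoped BigOperators Matrix ContDiff Matrix.Norms.Frobenius
open Literature.MathematicalPhysics.QuantumLattice

namespace Summit.QuantumFields.QCD.Cruxes.EarlyCrosserLaw.ZeroModeFloorDiluteGas

/-! ## Block structure of the gamma matrices -/

/-- Upper rows of the Dirac operator only see lower components and vice versa: contracting `γ_μ` with
a family `d μ s'` truncated to the upper block `s' < 2` gives `0` in the upper rows and the full
contraction in the lower rows. -/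
theorem sum_gamma_mul_ite_lt_two (d : Fin 4 → Fin 4 → ℂ) (s : Fin 4) :
    (∑ μ : Fin 4, ∑ s' : Fin 4, euclideanGamma μ s s' * (if (s' : ℕ) < 2 then d μ s' else 0)) =
      if (s : ℕ) < 2 then 0 else ∑ μ : Fin 4, ∑ s' : Fin 4, euclideanGamma μ s s' * d μ s' := by
  fin_cases s <;>
    simp [Fin.sum_univ_four, euclideanGamma_zero, euclideanGamma_one, euclideanGamma_two, euclideanGamma_three]

/-- Same for the truncation to the lower block `¬ s' < 2`. -/
theorem sum_gamma_mul_ite_not_lt_two (d : Fin 4 → Fin 4 → ℂ) (s : Fin 4) :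
    (∑ μ : Fin 4, ∑ s' : Fin 4, euclideanGamma μ s s' * (if (s' : ℕ) < 2 then 0 else d μ s')) =
      if (s : ℕ) < 2 then ∑ μ : Fin 4, ∑ s' : Fin 4, euclideanGamma μ s s' * d μ s' else 0 := by
  fin_cases s <;>
    simp [Fin.sum_univ_four, euclideanGamma_zero, euclideanGamma_one, euclideanGamma_two, euclideanGamma_three]

/-! ## The chirality projections of a spinor field -/

/-- The upper chirality projection of a smooth spinor field is smooth. -/
theorem contDiff_chiralUpper {ψ : EuclideanSpace ℝ (Fin 4) → Fin 4 → Fin 3 → ℂ} (hψ : ContDiff ℝ ∞ ψ) :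
    ContDiff ℝ ∞ (fun x (s : Fin 4) (c : Fin 3) => if (s : ℕ) < 2 then ψ x s c else 0) := by
  refine contDiff_pi.2 fun s => contDiff_pi.2 fun c => ?_
  by_cases h : (s : ℕ) < 2
  · simp only [h, if_true]; exact contDiff_pi.1 (contDiff_pi.1 hψ s) c
  · simp only [h, if_false]; exact contDiff_const

/-- The lower chirality projection of a smooth spinor field is smooth. -/
theorem contDiff_chiralLower {ψ : EuclideanSpace ℝ (Fin 4) → Fin 4 → Fin 3 → ℂ} (hψ : ContDiff ℝ ∞ ψ) :
    ContDiff ℝ ∞ (fun x (s : Fin 4) (c : Fin 3) => if (s : ℕ) < 2 then 0 else ψ x s c) := by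
  refine contDiff_pi.2 fun s => contDiff_pi.2 fun c => ?_
  by_cases h : (s : ℕ) < 2
  · simp only [h, if_true]; exact contDiff_const
  · simp only [h, if_false]; exact contDiff_pi.1 (contDiff_pi.1 hψ s) c

/-- Covariant-derivative components of the upper projection: truncation of those of `ψ`. -/
theorem covDeriv_chiralUpper (A : Connection (EuclideanSpace ℝ (Fin 4)) (Matrix (Fin 3) (Fin 3) ℂ))
    (ψ : EuclideanSpace ℝ (Fin 4) → Fin 4 → Fin 3 → ℂ) (x v : EuclideanSpace ℝ (Fin 4)) (s : Fin 4) (c : Fin 3) :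
    fderiv ℝ (fun y => (if (s : ℕ) < 2 then ψ y s c else 0)) x v +
        ∑ c' : Fin 3, A x v c c' * (if (s : ℕ) < 2 then ψ x s c' else 0)
      = if (s : ℕ) < 2 then fderiv ℝ (fun y => ψ y s c) x v + ∑ c' : Fin 3, A x v c c' * ψ x s c' else 0 := by
  by_cases h : (s : ℕ) < 2 <;> simp [h]

/-- Covariant-derivative components of the lower projection: truncation of those of `ψ`. -/
theorem covDeriv_chiralLower (A : Connection (EuclideanSpace ℝ (Fin 4)) (Matrix (Fin 3) (Fin 3) ℂ))
    (ψ : EuclideanSpace ℝ (Fin 4) → Fin 4 → Fin 3 → ℂ) (x v : EuclideanSpace ℝ (Fin 4)) (s : Fin 4) (c : Fin 3) :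
    fderiv ℝ (fun y => (if (s : ℕ) < 2 then 0 else ψ y s c)) x v +
        ∑ c' : Fin 3, A x v c c' * (if (s : ℕ) < 2 then 0 else ψ x s c')
      = if (s : ℕ) < 2 then 0 else fderiv ℝ (fun y => ψ y s c) x v + ∑ c' : Fin 3, A x v c c' * ψ x s c' := by
  by_cases h : (s : ℕ) < 2 <;> simp [h]

/-- **The upper projection of a Dirac-harmonic spinor field is Dirac-harmonic.** -/
theorem dirac_chiralUpper (A : Connection (EuclideanSpace ℝ (Fin 4)) (Matrix (Fin 3) (Fin 3) ℂ))
    (ψ : EuclideanSpace ℝ (Fin 4) → Fin 4 → Fin 3 → ℂ)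
    (hD : ∀ x s c, ∑ μ : Fin 4, ∑ s' : Fin 4, euclideanGamma μ s s' *
      (fderiv ℝ (fun y => ψ y s' c) x (EuclideanSpace.single μ (1 : ℝ)) +
        ∑ c' : Fin 3, A x (EuclideanSpace.single μ (1 : ℝ)) c c' * ψ x s' c') = 0) :
    ∀ x s c, ∑ μ : Fin 4, ∑ s' : Fin 4, euclideanGamma μ s s' *
      (fderiv ℝ (fun y => (fun x (s : Fin 4) (c : Fin 3) => if (s : ℕ) < 2 then ψ x s c else 0) y s' c) x
          (EuclideanSpace.single μ (1 : ℝ)) +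
        ∑ c' : Fin 3, A x (EuclideanSpace.single μ (1 : ℝ)) c c' *
          (fun x (s : Fin 4) (c : Fin 3) => if (s : ℕ) < 2 then ψ x s c else 0) x s' c') = 0 := by
  intro x s c
  simp only [covDeriv_chiralUpper]
  rw [sum_gamma_mul_ite_lt_two (fun μ s' => fderiv ℝ (fun y => ψ y s' c) x (EuclideanSpace.single μ (1 : ℝ)) +
    ∑ c' : Fin 3, A x (EuclideanSpace.single μ (1 : ℝ)) c c' * ψ x s' c') s]
  split_ifs
  · rfl
  · exact hD x s c

/-- **The lower projection of a Dirac-harmonic spinor field is Dirac-harmonic.** -/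
theorem dirac_chiralLower (A : Connection (EuclideanSpace ℝ (Fin 4)) (Matrix (Fin 3) (Fin 3) ℂ))
    (ψ : EuclideanSpace ℝ (Fin 4) → Fin 4 → Fin 3 → ℂ)
    (hD : ∀ x s c, ∑ μ : Fin 4, ∑ s' : Fin 4, euclideanGamma μ s s' *
      (fderiv ℝ (fun y => ψ y s' c) x (EuclideanSpace.single μ (1 : ℝ)) +
        ∑ c' : Fin 3, A x (EuclideanSpace.single μ (1 : ℝ)) c c' * ψ x s' c') = 0) :
    ∀ x s c, ∑ μ : Fin 4, ∑ s' : Fin 4, euclideanGamma μ s s' *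
      (fderiv ℝ (fun y => (fun x (s : Fin 4) (c : Fin 3) => if (s : ℕ) < 2 then 0 else ψ x s c) y s' c) x
          (EuclideanSpace.single μ (1 : ℝ)) +
        ∑ c' : Fin 3, A x (EuclideanSpace.single μ (1 : ℝ)) c c' *
          (fun x (s : Fin 4) (c : Fin 3) => if (s : ℕ) < 2 then 0 else ψ x s c) x s' c') = 0 := by
  intro x s c
  simp only [covDeriv_chiralLower]
  rw [sum_gamma_mul_ite_not_lt_two (fun μ s' => fderiv ℝ (fun y => ψ y s' c) x (EuclideanSpace.single μ (1 : ℝ)) +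
    ∑ c' : Fin 3, A x (EuclideanSpace.single μ (1 : ℝ)) c c' * ψ x s' c') s]
  split_ifs
  · exact hD x s c
  · rfl

/-! ## Additive splitting of the densities -/

/-- Modulus density of the upper projection. -/
theorem normSq_chiralUpper (ψ : EuclideanSpace ℝ (Fin 4) → Fin 4 → Fin 3 → ℂ) (x : EuclideanSpace ℝ (Fin 4)) :
    (∑ s : Fin 4, ∑ c : Fin 3, ‖(fun x (s : Fin 4) (c : Fin 3) => if (s : ℕ) < 2 then ψ x s c else 0) x s c‖ ^ 2)
      = ∑ c : Fin 3, (‖ψ x 0 c‖ ^ 2 + ‖ψ x 1 c‖ ^ 2) := by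
  simp [Fin.sum_univ_four, Finset.sum_add_distrib]

/-- Modulus density of the lower projection. -/
theorem normSq_chiralLower (ψ : EuclideanSpace ℝ (Fin 4) → Fin 4 → Fin 3 → ℂ) (x : EuclideanSpace ℝ (Fin 4)) :
    (∑ s : Fin 4, ∑ c : Fin 3, ‖(fun x (s : Fin 4) (c : Fin 3) => if (s : ℕ) < 2 then 0 else ψ x s c) x s c‖ ^ 2)
      = ∑ c : Fin 3, (‖ψ x 2 c‖ ^ 2 + ‖ψ x 3 c‖ ^ 2) := by
  simp [Fin.sum_univ_four, Finset.sum_add_distrib]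

/-- The modulus density splits: `|ψ|² = |ψ₊|² + |ψ₋|²`. -/
theorem normSq_split (ψ : EuclideanSpace ℝ (Fin 4) → Fin 4 → Fin 3 → ℂ) (x : EuclideanSpace ℝ (Fin 4)) :
    (∑ s : Fin 4, ∑ c : Fin 3, ‖ψ x s c‖ ^ 2)
      = (∑ c : Fin 3, (‖ψ x 0 c‖ ^ 2 + ‖ψ x 1 c‖ ^ 2)) + ∑ c : Fin 3, (‖ψ x 2 c‖ ^ 2 + ‖ψ x 3 c‖ ^ 2) := by
  simp only [Fin.sum_univ_four, Finset.sum_add_distrib]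
  ring

/-- Covariant-gradient density of the upper projection. -/
theorem gradSq_chiralUpper (A : Connection (EuclideanSpace ℝ (Fin 4)) (Matrix (Fin 3) (Fin 3) ℂ))
    (ψ : EuclideanSpace ℝ (Fin 4) → Fin 4 → Fin 3 → ℂ) (x : EuclideanSpace ℝ (Fin 4)) :
    (∑ μ : Fin 4, ∑ s : Fin 4, ∑ c : Fin 3,
      ‖fderiv ℝ (fun z => (fun x (s : Fin 4) (c : Fin 3) => if (s : ℕ) < 2 then ψ x s c else 0) z s c) x
          (EuclideanSpace.single μ (1 : ℝ)) +
        ∑ c' : Fin 3, A x (EuclideanSpace.single μ (1 : ℝ)) c c' *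
          (fun x (s : Fin 4) (c : Fin 3) => if (s : ℕ) < 2 then ψ x s c else 0) x s c'‖ ^ 2)
    = ∑ μ : Fin 4, ∑ c : Fin 3,
        (‖fderiv ℝ (fun z => ψ z 0 c) x (EuclideanSpace.single μ (1 : ℝ)) +
            ∑ c' : Fin 3, A x (EuclideanSpace.single μ (1 : ℝ)) c c' * ψ x 0 c'‖ ^ 2 +
          ‖fderiv ℝ (fun z => ψ z 1 c) x (EuclideanSpace.single μ (1 : ℝ)) +
            ∑ c' : Fin 3, A x (EuclideanSpace.single μ (1 : ℝ)) c c' * ψ x 1 c'‖ ^ 2) := by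
  simp only [covDeriv_chiralUpper]
  refine Finset.sum_congr rfl fun μ _ => ?_
  simp [Fin.sum_univ_four, Finset.sum_add_distrib]

/-- Covariant-gradient density of the lower projection. -/
theorem gradSq_chiralLower (A : Connection (EuclideanSpace ℝ (Fin 4)) (Matrix (Fin 3) (Fin 3) ℂ))
    (ψ : EuclideanSpace ℝ (Fin 4) → Fin 4 → Fin 3 → ℂ) (x : EuclideanSpace ℝ (Fin 4)) :
    (∑ μ : Fin 4, ∑ s : Fin 4, ∑ c : Fin 3,
      ‖fderiv ℝ (fun z => (fun x (s : Fin 4) (c : Fin 3) => if (s : ℕ) < 2 then 0 else ψ x s c) z s c) x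
          (EuclideanSpace.single μ (1 : ℝ)) +
        ∑ c' : Fin 3, A x (EuclideanSpace.single μ (1 : ℝ)) c c' *
          (fun x (s : Fin 4) (c : Fin 3) => if (s : ℕ) < 2 then 0 else ψ x s c) x s c'‖ ^ 2)
    = ∑ μ : Fin 4, ∑ c : Fin 3,
        (‖fderiv ℝ (fun z => ψ z 2 c) x (EuclideanSpace.single μ (1 : ℝ)) +
            ∑ c' : Fin 3, A x (EuclideanSpace.single μ (1 : ℝ)) c c' * ψ x 2 c'‖ ^ 2 +
          ‖fderiv ℝ (fun z => ψ z 3 c) x (EuclideanSpace.single μ (1 : ℝ)) +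
            ∑ c' : Fin 3, A x (EuclideanSpace.single μ (1 : ℝ)) c c' * ψ x 3 c'‖ ^ 2) := by
  simp only [covDeriv_chiralLower]
  refine Finset.sum_congr rfl fun μ _ => ?_
  simp [Fin.sum_univ_four, Finset.sum_add_distrib]

/-- The covariant-gradient density splits: `|∇ψ|² = |∇ψ₊|² + |∇ψ₋|²`. -/
theorem gradSq_split (A : Connection (EuclideanSpace ℝ (Fin 4)) (Matrix (Fin 3) (Fin 3) ℂ))
    (ψ : EuclideanSpace ℝ (Fin 4) → Fin 4 → Fin 3 → ℂ) (x : EuclideanSpace ℝ (Fin 4)) :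
    (∑ μ : Fin 4, ∑ s : Fin 4, ∑ c : Fin 3,
      ‖fderiv ℝ (fun z => ψ z s c) x (EuclideanSpace.single μ (1 : ℝ)) +
        ∑ c' : Fin 3, A x (EuclideanSpace.single μ (1 : ℝ)) c c' * ψ x s c'‖ ^ 2)
    = (∑ μ : Fin 4, ∑ c : Fin 3,
        (‖fderiv ℝ (fun z => ψ z 0 c) x (EuclideanSpace.single μ (1 : ℝ)) +
            ∑ c' : Fin 3, A x (EuclideanSpace.single μ (1 : ℝ)) c c' * ψ x 0 c'‖ ^ 2 +
          ‖fderiv ℝ (fun z => ψ z 1 c) x (EuclideanSpace.single μ (1 : ℝ)) +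
            ∑ c' : Fin 3, A x (EuclideanSpace.single μ (1 : ℝ)) c c' * ψ x 1 c'‖ ^ 2))
      + ∑ μ : Fin 4, ∑ c : Fin 3,
        (‖fderiv ℝ (fun z => ψ z 2 c) x (EuclideanSpace.single μ (1 : ℝ)) +
            ∑ c' : Fin 3, A x (EuclideanSpace.single μ (1 : ℝ)) c c' * ψ x 2 c'‖ ^ 2 +
          ‖fderiv ℝ (fun z => ψ z 3 c) x (EuclideanSpace.single μ (1 : ℝ)) +
            ∑ c' : Fin 3, A x (EuclideanSpace.single μ (1 : ℝ)) c c' * ψ x 3 c'‖ ^ 2) := by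
  rw [← Finset.sum_add_distrib]
  refine Finset.sum_congr rfl fun μ _ => ?_
  simp only [Fin.sum_univ_four, Finset.sum_add_distrib]
  ring

end Summit.QuantumFields.QCD.Cruxes.EarlyCrosserLaw.ZeroModeFloorDiluteGas

end
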